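import Mathlib.Probability.Independence.InfinitePi
import Mathlib.Probability.Independence.Integration
import Literature.ComputerArithmetic.HighamMary2020.RandomData

/-!
# Higham–Mary (2020), §3: probabilistic error analysis of INNER PRODUCTS, MATRIX–VECTOR and
# MATRIX–MATRIX PRODUCTS with random data (Corollary 3.1, Theorems 3.2, 3.3, 3.4)

N. J. Higham, T. Mary, *Sharper probabilistic backward error analysis for basic linear algebra
kernels with random data*, SIAM J. Sci. Comput. 42 (5) (2020) A3427–A3446,
doi:10.1137/20M1314355 — Section 3 "Application to basic linear algebra kernels": the analysis of
recursive summation under Models 2 and 3 of §2.2 (this directory's `RandomData`) applied to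
`xᵀy = Σ_j x_j y_j`, `y = Ax` and `C = AB`.

* §3 CONVENTION ("`x` and `y` satisfy Model 2"): each vector / matrix has entries satisfying
  Model 2 with its own mean and bound, and ALL the random variables comprising the entries of the
  objects named are MUTUALLY INDEPENDENT (so one cannot take `A = B`). Typed as
  `Model2Pair μ ξ η mx Cx my Cy`: the juxtaposed family `Sum.elim ξ η`, indexed by `ι ⊕ ι'`, is
  independent (`iIndepFun`), and each half satisfies Model 2 (`Model2Pair.left/right`). Sub-objects
  (a row of `A` together with `x`; a row of `A` together with a column of `B`) inherit it
  (`Model2Pair.restrict`). The step "the `z_j = x_j y_j` satisfy Model 2 with `E(z_j) = μ_x μ_y`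
  and `|z_j| ≤ C_x C_y`" of the proof of Theorem 3.2 is `Model2Pair.mul` (independence of the
  products = independence of the pairwise disjoint blocks `{x_j, y_j}` of an independent family,
  from Mathlib's product-measure characterisation of `iIndepFun`; the mean by
  `IndepFun.integral_fun_mul_eq_mul_integral`).
* "`|x|` and `|y|` satisfy Model 2 with means `μ_|x|`, `μ_|y|`": given the convention for `x, y`,
  the absolute values are again mutually independent and bounded by the same constants, so the
  extra content is exactly that the `|x_j|` (resp. `|y_j|`) have a COMMON mean — the hypotheses
  `∀ j, ∫ |x_j| = μ_|x|`, `∀ j, ∫ |y_j| = μ_|y|` below (`Model2Pair.abs`).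
* COROLLARY 3.1: `|x|ᵀ|y| ≥ α μ_|x| μ_|y| n` with probability `≥ 1 − 2 exp(−λ²/2)` whenever
  `(1 − α) μ_|x| μ_|y| √n ≥ λ C_x C_y` (Lemma 2.9 for `w_j = |x_j y_j|`)
  (`Model2Pair.absDot_lower_probBound`).
* eq. (3.1): the backward error of an approximate inner product,
  `ε_bwd(ŝ) = min{ε : ŝ = Σ_j x_j y_j (1 + θ_j), |θ_j| ≤ ε} = |ŝ − s| / |x|ᵀ|y|` — the tree's
  `BlanchardHighamMary2020.IsBackwardSum s (fun j => x_j y_j) ŝ ε` (perturbations carried by the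
  products), read off from `|ŝ − s| ≤ ε |x|ᵀ|y|` by `GeneralData.isBackwardSum_of_abs_sub_le`.
* MODEL 3 for an inner product: the rounding errors `δ_k` of the SUMMATION are mean independent of
  the previous ones and of the data; what the proof uses is mean independence of the products
  `z = (x_j y_j)_j` being summed, `Model3 μ u δ z`, which mean independence of `x` and `y` implies
  (`Model3.dataMap`: Model 3 is inherited by measurable functions of the data). The rounding errors
  `ε_j` of the MULTIPLICATIONS (3.4), `ẑ_j = x_j y_j (1 + ε_j)`, enter only through `|ε_j| ≤ u`:
  they may depend on everything (not even measurability is needed, failure probabilities being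
  bounded through monotonicity of the measure).
* THEOREM 3.2, eq. (3.2): `|ŝ − s| ≤ (λ |μ_x μ_y| n^{3/2} + (λ² + 1) C_x C_y n) u + O(u²)` with
  probability `≥ 1 − 2n exp(−λ²/2)` (`recDot_probErrorBound_randomData`), the `O(u²)` EXPLICIT as
  `secondOrderDot u (C_x C_y) n = n (n+1) C_x C_y ((1+u)^n − 1) u` (our indexing) — it collects the
  `O(u²)` of Lemma 2.1 for the data `ẑ` (`|ẑ_j| ≤ C_x C_y (1+u)`) and the replacement of the
  partial sums `T_i` of `ẑ` by the partial sums `W_i` of `z` (`|T_i − W_i| ≤ i C_x C_y u`); and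
  eq. (3.3): `ε_bwd ≤ (α μ_|x| μ_|y|)⁻¹ (λ |μ_x μ_y| √n + (λ² + 1) C_x C_y) u + O(u²)` with
  probability `≥ 1 − 2(n+1) exp(−λ²/2)` (`recDot_probBackwardError_randomData`). The computed
  inner product is the tree's `Higham2002.recDot x y ε δ` (products `x_j y_j (1 + ε_j)`, then
  recursive summation with the `δ_k`) `= recSum ẑ δ` (`recDot_eq_recSum`); the deterministic core
  of the proof (Lemma 2.1 for `ẑ`, `ẑ_j = z_j + O(u)`, the triangle inequality with
  `|t − s| ≤ C_x C_y n u`) is `abs_recDot_sub_sum_le_dataCoef`.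
* eq. (3.6) (Oettli–Prager for `y = Ax`): `ε_bwd(ŷ) = min{ε : ŷ = (A + ΔA)x, |ΔA| ≤ ε|A|}
  = max_i |ŷ_i − y_i| / (|A||x|)_i`; "`ε_bwd(ŷ) ≤ ε`" is typed ROW-WISE as
  `∀ i, IsBackwardSum cols (fun j => a_ij x_j) ŷ_i ε`, which gives `ŷ = (A + ΔA)x`, `|ΔA| ≤ ε|A|`
  (`exists_perturbation_of_rows`, the tree's `BlanchardHighamMary2020.theorem42_mulVec`).
* THEOREM 3.3, eq. (3.7): for `y = Ax`, `A ∈ ℝ^{m×n}`, computed by `m` inner products,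
  `ε_bwd(ŷ) ≤ (α μ_|A| μ_|x|)⁻¹ (λ |μ_A μ_x| √n + (λ² + 1) C_A C_x) u + O(u²)` with probability
  `≥ 1 − 2m(n+1) exp(−λ²/2)` (`mulVec_probBackwardError_randomData`: Theorem 3.2 per row and a
  union bound over the rows).
* THEOREM 3.4, eq. (3.8): for `C = AB`, `max_{i,j} |(Ĉ − C)_{ij}| ≤ (λ |μ_A μ_B| n^{3/2}
  + (λ² + 1) C_A C_B n) u + O(u²)` with probability `≥ 1 − 2mnp exp(−λ²/2)`
  (`matMul_probErrorBound_randomData`: Theorem 3.2 per entry, union bound over the `mp` entries).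

INDEXING as in `GeneralData` / `RandomData`: an inner product of length `n + 1` (indices
`j = 0, …, n`; the source's `n`), `n` additions with rounding errors `δ_1, …, δ_n`; so the source's
`n`, `n^{3/2}`, `√n` read `n + 1`, `(n+1) √(n+1)`, `√(n+1)`, and the failure probabilities
`2n exp(−λ²/2)`, `2(n+1) exp(−λ²/2)`, `2m(n+1) exp(−λ²/2)`, `2mnp exp(−λ²/2)` read
`2(n+1) exp(−λ²/2)`, `2(n+2) exp(−λ²/2)`, `2m(n+2) exp(−λ²/2)`, `2m(n+1)p exp(−λ²/2)`. Rows of `A`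
(`i ∈ rows`) and columns of `B` (`k ∈ cols`) range over arbitrary finite sets of arbitrary index
types; the inner dimension is `range (n + 1)`.

TYPING NOTES. (1) As in `RandomData`, failure events are STRICT (`bound < |error|`) and
"`P(|e| ≤ B) ≥ 1 − p`" is `μ {ω | B < |e ω|} ≤ ENNReal.ofReal p`. (2) The source's `α ∈ [0,1]`:
only the displayed condition `(1 − α) μ_|x| μ_|y| √n ≥ λ C_x C_y` is used by the proofs, plus
`0 < α` where the bound is divided by `α` (for `α = 0` the printed bounds (3.3)/(3.7) are `+∞`).
(3) Each inner product of Theorems 3.3/3.4 has its own rounding errors `δ^{(i)}`, `ε^{(i)}`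
(resp. `δ^{(i,k)}`, `ε^{(i,k)}`), each summation satisfying Model 3 with respect to its own data.

NOT typed here: the discussion (2.15)–(2.17) of the condition number `κ`, §4 (Algorithms 4.1/4.2,
Theorems 4.1/4.2: reducing the backward error by shifting the data to zero mean), §5 (experiments).
-/

namespace Literature.ComputerArithmetic.HighamMary2020

open MeasureTheory ProbabilityTheory Finset Real
open scoped NNReal ENNReal

open Literature.ComputerArithmetic.Higham2002 (recSum recDot)
open Literature.ComputerArithmetic.BlanchardHighamMary2020 (IsBackwardSum theorem42_mulVec)

variable {Ω : Type*} [MeasurableSpace Ω] {μ : Measure Ω}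

/-! ### The §3 convention "`x` and `y` satisfy Model 2": two mutually independent families -/

/-- **"`x` and `y` satisfy Model 2"** (§3 convention): the entries `x_i` (`i : ι`) satisfy Model 2
with mean `mx = μ_x` and bound `Cx = C_x`, the entries `y_j` (`j : ι'`) satisfy Model 2 with mean
`my = μ_y` and bound `Cy = C_y`, and ALL the random variables `x_i, y_j` are mutually independent:
the juxtaposed family `Sum.elim ξ η : ι ⊕ ι' → Ω → ℝ` is independent. Vectors are families indexed
by `ℕ`, matrices families indexed by pairs.
[cite: HighamMary2020, §3, first paragraph ("a vector or a matrix `W` is said to satisfy Model 2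
with mean `μ` and bound `C` if its entries `w_ij` satisfy the model with `E(w_ij) = μ` and
`|w_ij| ≤ C` … When we write 'let `A`, `B`, and `C` satisfy Model 2', this is understood to mean
that all the random variables comprising the elements of `A`, `B`, and `C` are mutually
independent")] -/
structure Model2Pair (μ : Measure Ω) {ι ι' : Type*} (ξ : ι → Ω → ℝ) (η : ι' → Ω → ℝ)
    (mx Cx my Cy : ℝ) : Prop where
  indep : iIndepFun (Sum.elim ξ η) μ
  measurable_left : ∀ i, Measurable (ξ i)
  measurable_right : ∀ j, Measurable (η j)
  integral_left : ∀ i, ∫ ω, ξ i ω ∂μ = mx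
  integral_right : ∀ j, ∫ ω, η j ω ∂μ = my
  bounded_left : ∀ i ω, |ξ i ω| ≤ Cx
  bounded_right : ∀ j ω, |η j ω| ≤ Cy

/-- [folklore] Disjoint blocks of an independent family are independent: if random variables
`X i j` indexed by PAIRS `(i, j)` are mutually independent, then the block vectors `(X i j)_j`, as
`(κ → 𝓧)`-valued random variables indexed by `i`, are independent (the converse direction of
Mathlib's `iIndepFun_uncurry'`; proof through the product-measure characterisation
`iIndepFun_iff_map_fun_eq_infinitePi_map` and `Measure.infinitePi_map_curry`). -/
private theorem iIndepFun_blocks {ι κ 𝓧 : Type*} [MeasurableSpace 𝓧] {X : ι → κ → Ω → 𝓧}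
    (mX : ∀ i j, Measurable (X i j)) (h : iIndepFun (fun p : ι × κ => X p.1 p.2) μ) :
    iIndepFun (fun i ω => fun j => X i j ω) μ := by
  have := h.isProbabilityMeasure
  have _hprob : ∀ i j, IsProbabilityMeasure (μ.map (X i j)) := fun i j =>
    Measure.isProbabilityMeasure_map (mX i j).aemeasurable
  refine (iIndepFun_iff_map_fun_eq_infinitePi_map (P := μ) (X := fun i ω => fun j => X i j ω)
    (fun i => measurable_pi_lambda _ (fun j => mX i j))).2 ?_
  calc μ.map (fun ω i j => X i j ω)
      = (μ.map (fun ω (p : ι × κ) => X p.1 p.2 ω)).map (MeasurableEquiv.curry ι κ 𝓧) := by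
        rw [Measure.map_map (MeasurableEquiv.curry ι κ 𝓧).measurable
          (measurable_pi_lambda _ (fun p : ι × κ => mX p.1 p.2))]
        rfl
    _ = (Measure.infinitePi fun p : ι × κ => μ.map (X p.1 p.2)).map
          (MeasurableEquiv.curry ι κ 𝓧) := by
        rw [h.map_fun_eq_infinitePi_map (fun p : ι × κ => mX p.1 p.2)]
    _ = Measure.infinitePi fun i => Measure.infinitePi fun j => μ.map (X i j) :=
        Measure.infinitePi_map_curry (fun i j => μ.map (X i j))
    _ = Measure.infinitePi fun i => μ.map (fun ω j => X i j ω) := by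
        congr 1
        funext i
        exact ((h.precomp (g := fun j : κ => (i, j)) fun a b hab => (Prod.mk.inj hab).2)
          |>.map_fun_eq_infinitePi_map fun j => mX i j).symm

namespace Model2Pair

section General

variable {ι ι' : Type*} {ξ : ι → Ω → ℝ} {η : ι' → Ω → ℝ} {mx Cx my Cy : ℝ}

/-- `x` satisfies Model 2. [cite: HighamMary2020, §3, first paragraph] -/
theorem left (h : Model2Pair μ ξ η mx Cx my Cy) : Model2 μ ξ mx Cx where
  indep := (h.indep.precomp Sum.inl_injective :)
  measurable := h.measurable_left
  integral_eq := h.integral_left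
  bounded := h.bounded_left

/-- `y` satisfies Model 2. [cite: HighamMary2020, §3, first paragraph] -/
theorem right (h : Model2Pair μ ξ η mx Cx my Cy) : Model2 μ η my Cy where
  indep := (h.indep.precomp Sum.inr_injective :)
  measurable := h.measurable_right
  integral_eq := h.integral_right
  bounded := h.bounded_right

/-- SUB-OBJECTS inherit the convention: re-indexing each family along an injection (a row of a
matrix together with the vector; a row of `A` together with a column of `B`) again gives two
mutually independent Model-2 families. [cite: HighamMary2020, §3, first paragraph, as used in the
proofs of Theorems 3.3 and 3.4 ("The bound … holds for any given `i` … by Theorem 3.2")] -/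
theorem restrict (h : Model2Pair μ ξ η mx Cx my Cy) {κ κ' : Type*} {f : κ → ι} {g : κ' → ι'}
    (hf : Function.Injective f) (hg : Function.Injective g) :
    Model2Pair μ (fun k => ξ (f k)) (fun k => η (g k)) mx Cx my Cy where
  indep := by
    have heq : Sum.elim (fun k => ξ (f k)) (fun k => η (g k))
        = fun k => Sum.elim ξ η (Sum.map f g k) :=
      funext fun k => by cases k <;> rfl
    rw [heq]
    exact h.indep.precomp (hf.sumMap hg)
  measurable_left k := h.measurable_left (f k)
  measurable_right k := h.measurable_right (g k)
  integral_left k := h.integral_left (f k)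
  integral_right k := h.integral_right (g k)
  bounded_left k := h.bounded_left (f k)
  bounded_right k := h.bounded_right (g k)

/-- "`|x|` and `|y|` satisfy Model 2 with means `μ_|x|`, `μ_|y|`": given the convention for
`x, y`, the absolute values are again mutually independent and bounded by `C_x`, `C_y`; the extra
hypothesis is a COMMON mean `mxa = μ_|x|` of the `|x_i|` and `mya = μ_|y|` of the `|y_j|`.
[cite: HighamMary2020, §3, first paragraph ("we also write `μ_|W|` for the mean of the absolute
values of the entries, `E(|w_ij|)`, which is the same for all `i` and `j` by assumption")] -/
theorem abs (h : Model2Pair μ ξ η mx Cx my Cy) {mxa mya : ℝ}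
    (hx : ∀ i, ∫ ω, |ξ i ω| ∂μ = mxa) (hy : ∀ j, ∫ ω, |η j ω| ∂μ = mya) :
    Model2Pair μ (fun i ω => |ξ i ω|) (fun j ω => |η j ω|) mxa Cx mya Cy where
  indep := by
    have heq : Sum.elim (fun i ω => |ξ i ω|) (fun j ω => |η j ω|)
        = fun k => (fun t : ℝ => |t|) ∘ Sum.elim ξ η k :=
      funext fun k => by cases k <;> rfl
    rw [heq]
    exact h.indep.comp (fun _ (t : ℝ) => |t|) (fun _ => continuous_abs.measurable)
  measurable_left i := continuous_abs.measurable.comp (h.measurable_left i)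
  measurable_right j := continuous_abs.measurable.comp (h.measurable_right j)
  integral_left := hx
  integral_right := hy
  bounded_left i ω := (abs_abs (ξ i ω)).trans_le (h.bounded_left i ω)
  bounded_right j ω := (abs_abs (η j ω)).trans_le (h.bounded_right j ω)

end General

section SameIndex

variable {ι : Type*} {ξ η : ι → Ω → ℝ} {mx Cx my Cy : ℝ}

/-- **The entrywise products `z_j = x_j y_j` of two mutually independent families are
independent**: the `z_j` are functions of the pairwise disjoint blocks `{x_j, y_j}`.
[cite: HighamMary2020, §3, Theorem 3.2, proof ("the `z_j` satisfy Model 2")] -/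
theorem iIndepFun_mul (h : Model2Pair μ ξ η mx Cx my Cy) :
    iIndepFun (fun j ω => ξ j ω * η j ω) μ := by
  -- re-index `ι ⊕ ι` by `ι × Bool`: `(j, false) ↦ inl j`, `(j, true) ↦ inr j`
  set g : ι × Bool → ι ⊕ ι := fun p => cond p.2 (Sum.inr p.1) (Sum.inl p.1) with hg
  have hginj : Function.Injective g := by
    rintro ⟨a, _ | _⟩ ⟨a', _ | _⟩ hab <;> simp [hg] at hab <;> simp [hab]
  set X : ι → Bool → Ω → ℝ := fun j b => Sum.elim ξ η (g (j, b)) with hX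
  have hXm : ∀ j b, Measurable (X j b) := by
    intro j b
    cases b
    · exact h.measurable_left j
    · exact h.measurable_right j
  have h1 : iIndepFun (fun p : ι × Bool => X p.1 p.2) μ := h.indep.precomp hginj
  have h2 := iIndepFun_blocks hXm h1
  have h3 := h2.comp (fun _ (f : Bool → ℝ) => f false * f true)
    (fun _ => (measurable_pi_apply false).mul (measurable_pi_apply true))
  have heq : (fun j ω => ξ j ω * η j ω)
      = fun j => (fun f : Bool → ℝ => f false * f true) ∘ fun ω b => X j b ω :=
    funext fun j => funext fun ω => by simp [hX, hg, Function.comp]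
  rw [heq]
  exact h3

/-- **"The `z_j = x_j y_j` satisfy Model 2 with `E(z_j) = μ_x μ_y` and `|z_j| ≤ C_x C_y`"** (the
mean by independence of `x_j` and `y_j`).
[cite: HighamMary2020, §3, Theorem 3.2, proof ("where `W_i = Σ_{j≤i} z_j` and where the `z_j`
satisfy Model 2 with `E(z_j) = μ_x μ_y` and `|z_j| ≤ C_x C_y`")] -/
theorem mul (h : Model2Pair μ ξ η mx Cx my Cy) :
    Model2 μ (fun j ω => ξ j ω * η j ω) (mx * my) (Cx * Cy) where
  indep := h.iIndepFun_mul
  measurable j := (h.measurable_left j).mul (h.measurable_right j)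
  integral_eq j := by
    have hind : IndepFun (ξ j) (η j) μ :=
      h.indep.indepFun (i := Sum.inl j) (j := Sum.inr j) Sum.inl_ne_inr
    show ∫ ω, ξ j ω * η j ω ∂μ = mx * my
    rw [hind.integral_fun_mul_eq_mul_integral (h.measurable_left j).aestronglyMeasurable
      (h.measurable_right j).aestronglyMeasurable]
    show (∫ ω, ξ j ω ∂μ) * (∫ ω, η j ω ∂μ) = mx * my
    rw [h.integral_left j, h.integral_right j]
  bounded j ω := by
    show |ξ j ω * η j ω| ≤ Cx * Cy
    rw [abs_mul]
    exact mul_le_mul (h.bounded_left j ω) (h.bounded_right j ω) (abs_nonneg _)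
      ((abs_nonneg _).trans (h.bounded_left j ω))

/-- `w_j = |x_j y_j| = |x_j| |y_j|` satisfies Model 2 with mean `μ_|x| μ_|y|` and bound `C_x C_y`
("since `|x|` and `|y|` are independent").
[cite: HighamMary2020, §3, Corollary 3.1, proof] -/
theorem absMul (h : Model2Pair μ ξ η mx Cx my Cy) {mxa mya : ℝ}
    (hx : ∀ i, ∫ ω, |ξ i ω| ∂μ = mxa) (hy : ∀ j, ∫ ω, |η j ω| ∂μ = mya) :
    Model2 μ (fun j ω => |ξ j ω * η j ω|) (mxa * mya) (Cx * Cy) := by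
  have heq : (fun j ω => |ξ j ω * η j ω|) = fun j ω => |ξ j ω| * |η j ω| :=
    funext fun j => funext fun ω => abs_mul _ _
  rw [heq]
  exact (h.abs hx hy).mul

/-- The bound `C_x C_y` of the products is nonnegative (nonempty index set).
[cite: HighamMary2020, §3, Theorem 3.2, proof ("`|z_j| ≤ C_x C_y`")] -/
theorem prod_const_nonneg [IsProbabilityMeasure μ] [Nonempty ι]
    (h : Model2Pair μ ξ η mx Cx my Cy) : 0 ≤ Cx * Cy :=
  h.mul.const_nonneg

end SameIndex

/-! ### COROLLARY 3.1: a probabilistic lower bound for `|x|ᵀ|y|` -/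

section Vectors

variable [IsProbabilityMeasure μ] {ξ η : ℕ → Ω → ℝ} {mx Cx my Cy : ℝ}

/-- **COROLLARY 3.1.** Let `|x|` and `|y|` satisfy Model 2 (means `mxa = μ_|x|`, `mya = μ_|y|`;
bounds `C_x`, `C_y`; all entries mutually independent). If
`(1 − α) μ_|x| μ_|y| √(n+1) ≥ λ C_x C_y` then `|x|ᵀ|y| = Σ_{j=0}^n |x_j y_j| ≥ α μ_|x| μ_|y| (n+1)`
with probability at least `1 − 2 exp(−λ²/2)` (Lemma 2.9 for `w_j = |x_j y_j|`,
`E(w_j) = E|x_j| E|y_j| = μ_|x| μ_|y|`). (Source indexing: `n` for our `n + 1`.)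
[cite: HighamMary2020, §3, Corollary 3.1] -/
theorem absDot_lower_probBound (h : Model2Pair μ ξ η mx Cx my Cy) {mxa mya : ℝ}
    (hx : ∀ i, ∫ ω, |ξ i ω| ∂μ = mxa) (hy : ∀ j, ∫ ω, |η j ω| ∂μ = mya) (n : ℕ) {α lam : ℝ}
    (hlam : 0 ≤ lam) (hcond : lam * (Cx * Cy) ≤ (1 - α) * (mxa * mya) * Real.sqrt (n + 1)) :
    μ {ω | ∑ j ∈ range (n + 1), |ξ j ω * η j ω| < α * (mxa * mya) * (n + 1)}
      ≤ ENNReal.ofReal (2 * Real.exp (-lam ^ 2 / 2)) := by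
  have hmx : 0 ≤ mxa := by rw [← hx 0]; exact integral_nonneg (fun ω => abs_nonneg _)
  have hmy : 0 ≤ mya := by rw [← hy 0]; exact integral_nonneg (fun ω => abs_nonneg _)
  have hm : |mxa * mya| = mxa * mya := abs_of_nonneg (mul_nonneg hmx hmy)
  have hcond' : lam * (Cx * Cy) ≤ (1 - α) * |mxa * mya| * Real.sqrt (n + 1) := by rwa [hm]
  refine Eq.trans_le ?_ ((h.absMul hx hy).sum_lower_probBound n hlam hcond')
  congr 1
  ext ω
  simp only [Set.mem_setOf_eq]
  rw [hm, abs_of_nonneg (sum_nonneg fun j _ => abs_nonneg (ξ j ω * η j ω))]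

end Vectors

end Model2Pair

/-! ### MODEL 3 for inner products: mean independence of functions of the data -/

/-- **Model 3 is inherited by (measurable) functions of the data**: if the rounding errors are mean
independent of the previous rounding errors and of the data `x`, they are mean independent of the
previous rounding errors and of any data vector `z = F(x)` computed measurably from `x` — e.g. the
products `z_j = x_j y_j` of an inner product, from the pair `(x, y)`.
[cite: HighamMary2020, §2.2, Model 3, eq. (2.11), as invoked in §3, Theorem 3.2, proof
("Therefore, by Lemma 2.7" — Lemma 2.7 applied to the data `z_j = x_j y_j` under Model 3)] -/
theorem Model3.dataMap {u : ℝ} {δ ξ ζ : ℕ → Ω → ℝ} (h : Model3 μ u δ ξ)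
    {F : (ℕ → ℝ) → (ℕ → ℝ)} (hF : Measurable F)
    (hζ : ∀ ω, (fun j => ζ j ω) = F (fun j => ξ j ω)) : Model3 μ u δ ζ where
  measurable := h.measurable
  bounded := h.bounded
  dataMeasurable j := by
    have hj : ζ j = fun ω => F (fun i => ξ i ω) j :=
      funext fun ω => (congrFun (hζ ω) j :)
    rw [hj]
    exact (measurable_pi_apply j).comp (hF.comp (measurable_pi_lambda _ h.dataMeasurable))
  meanIndep k G hG hdep hbd := by
    obtain ⟨B, hB⟩ := hbd
    have h0 := h.meanIndep k (fun p => G (p.1, F p.2))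
      (hG.comp (measurable_fst.prodMk (hF.comp measurable_snd)))
      (fun v w e hvw => hdep v w (F e) hvw) ⟨B, fun p => hB _⟩
    have hint : (fun ω => G (fun i => δ i ω, fun j => ζ j ω) * δ k ω)
        = fun ω => G (fun i => δ i ω, F (fun j => ξ j ω)) * δ k ω :=
      funext fun ω => by rw [hζ ω]
    rw [hint]
    exact h0

/-! ### The deterministic core of Theorem 3.2: Lemma 2.1 for the rounded products -/

section Algebra

variable {K : Type*} [Field K] [LinearOrder K] [IsStrictOrderedRing K]

omit [LinearOrder K] [IsStrictOrderedRing K] in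
/-- The computed inner product is the recursive summation of the ROUNDED PRODUCTS
`ẑ_j = x_j y_j (1 + ε_j)`: `recDot x y ε δ = recSum ẑ δ` ("Let `t = Σ_j ẑ_j` … Since `ŝ = t̂`").
[cite: HighamMary2020, §3, Theorem 3.2, proof, eq. (3.4)] -/
theorem recDot_eq_recSum (x y e d : ℕ → K) :
    ∀ n, recDot x y e d n = recSum (fun j => x j * y j * (1 + e j)) d n
  | 0 => by simp only [recDot, recSum]
  | n + 1 => by simp only [recDot, recSum, recDot_eq_recSum x y e d n]

omit [LinearOrder K] [IsStrictOrderedRing K] in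
/-- The data partial sums are additive in the data (`T_i = W_i + Σ_{j≤i} z_j ε_j` for
`ẑ_j = z_j + z_j ε_j`). [cite: HighamMary2020, §3, Theorem 3.2, proof ("since `ẑ_j = z_j + O(u)`,
we have `t̂ − t = Σ_i W_i δ_i + O(u²)`, where `W_i = Σ_{j≤i} z_j`")] -/
theorem dataCoef_add (v w : ℕ → K) :
    ∀ k, dataCoef (fun i => v i + w i) k = dataCoef v k + dataCoef w k
  | 0 => by simp [dataCoef]
  | k + 1 => by simp [dataCoef, sum_add_distrib]

/-- **The `O(u²)` produced by replacing `T_i` (partial sums of `ẑ`) by `W_i` (partial sums of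
`z`):** if `|w_j| ≤ B` (here `w_j = z_j ε_j`, `B = C_x C_y u`) and `|d_k| ≤ u` then
`|Σ_{k≤n} (Σ_{j≤k} w_j) d_k| ≤ n (n+1) B u`.
[cite: HighamMary2020, §3, Theorem 3.2, proof (the `O(u²)` of "`t̂ − t = Σ_i W_i δ_i + O(u²)`")] -/
theorem abs_sum_dataCoef_mul_le {u B : K} {w d : ℕ → K} (hw : ∀ i, |w i| ≤ B)
    (hd : ∀ k, |d k| ≤ u) (n : ℕ) :
    |∑ k ∈ range (n + 1), dataCoef w k * d k| ≤ n * ((n + 1) * B) * u := by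
  have hB : 0 ≤ B := (abs_nonneg _).trans (hw 0)
  have hterm : ∀ k ∈ range n, |dataCoef w (k + 1) * d (k + 1)| ≤ (n + 1) * B * u := by
    intro k hk
    have hk' : k < n := mem_range.mp hk
    rw [abs_mul]
    refine mul_le_mul ?_ (hd _) (abs_nonneg _) (mul_nonneg (by positivity) hB)
    simp only [dataCoef]
    have hcast : ((k + 2 : ℕ) : K) ≤ n + 1 := by exact_mod_cast (show k + 2 ≤ n + 1 by omega)
    calc |∑ i ∈ range (k + 2), w i| ≤ ∑ i ∈ range (k + 2), |w i| := abs_sum_le_sum_abs _ _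
      _ ≤ ∑ _i ∈ range (k + 2), B := sum_le_sum fun i _ => hw i
      _ = ((k + 2 : ℕ) : K) * B := by rw [sum_const, card_range, nsmul_eq_mul]
      _ ≤ (n + 1) * B := mul_le_mul_of_nonneg_right hcast hB
  calc |∑ k ∈ range (n + 1), dataCoef w k * d k|
      = |∑ k ∈ range n, dataCoef w (k + 1) * d (k + 1)| := by
        rw [sum_range_succ']; simp [dataCoef]
    _ ≤ ∑ k ∈ range n, |dataCoef w (k + 1) * d (k + 1)| := abs_sum_le_sum_abs _ _
    _ ≤ ∑ _k ∈ range n, (n + 1) * B * u := sum_le_sum hterm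
    _ = n * ((n + 1) * B) * u := by rw [sum_const, card_range, nsmul_eq_mul]; ring

end Algebra

/-- The SECOND-ORDER TERM of Theorem 3.2 made explicit (the `O(u²)` of (3.2), our indexing):
`n (n+1) C ((1+u)^n − 1) u` for products bounded by `C = C_x C_y` — the sum of the second-order
term `secondOrder u (C(1+u)) n` of Lemma 2.1 / Theorem 2.8 for the rounded products
(`|ẑ_j| ≤ C (1+u)`) and of `n (n+1) C u²` from `T_i − W_i = Σ_{j≤i} z_j ε_j`
(`secondOrderDot_eq`); a quantity `≤ n² (n+1) C u² (1+u)^{n−1}`.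
[cite: HighamMary2020, §3, Theorem 3.2, eq. (3.2) (the `O(u²)` term)] -/
noncomputable def secondOrderDot (u C : ℝ) (n : ℕ) : ℝ := n * (n + 1) * C * ((1 + u) ^ n - 1) * u

/-- `n (n+1) (C u) u + secondOrder u (C (1+u)) n = secondOrderDot u C n`.
[cite: HighamMary2020, §3, Theorem 3.2, proof (collecting the two `O(u²)` terms)] -/
theorem secondOrderDot_eq (u C : ℝ) (n : ℕ) :
    n * ((n + 1) * (C * u)) * u + secondOrder u (C * (1 + u)) n = secondOrderDot u C n := by
  unfold secondOrder secondOrderDot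
  cases n with
  | zero => simp
  | succ k =>
      simp only [Nat.add_sub_cancel]
      push_cast
      ring

/-- `secondOrderDot u C n ≥ 0` for `u, C ≥ 0`. [cite: HighamMary2020, §3, Theorem 3.2, eq. (3.2)] -/
theorem secondOrderDot_nonneg {u C : ℝ} (hu : 0 ≤ u) (hC : 0 ≤ C) (n : ℕ) :
    0 ≤ secondOrderDot u C n := by
  have : 0 ≤ (1 + u) ^ n - 1 := sub_nonneg.mpr (one_le_pow₀ (by linarith))
  unfold secondOrderDot
  positivity

/-- **The deterministic core of the proof of Theorem 3.2.** For products `z_j = x_j y_j` with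
`|z_j| ≤ C`, multiplication errors `|ε_j| ≤ u` and summation errors `|δ_k| ≤ u`,
`|ŝ − s| ≤ |Σ_k W_k δ_k| + (n+1) C u + secondOrderDot u C n`, where `W_k = Σ_{j≤k} z_j`
(`dataCoef z k`): Lemma 2.1 for the data `ẑ` (`t̂ − t = Σ T_i δ_i + O(u²)`), `T_i = W_i + O(u)`,
and the triangle inequality `|ŝ − s| ≤ |t̂ − t| + |t − s|` with
`|t − s| = |Σ_j z_j ε_j| ≤ C_x C_y n u`.
[cite: HighamMary2020, §3, Theorem 3.2, proof (from (3.4) to "combine (3.5) with the bound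
`|t − s| ≤ C_x C_y n u` to obtain (3.2)")] -/
theorem abs_recDot_sub_sum_le_dataCoef {u C : ℝ} {x y e d : ℕ → ℝ} (hz : ∀ j, |x j * y j| ≤ C)
    (he : ∀ j, |e j| ≤ u) (hd : ∀ k, |d k| ≤ u) (n : ℕ) :
    |recDot x y e d n - ∑ j ∈ range (n + 1), x j * y j|
      ≤ |∑ k ∈ range (n + 1), dataCoef (fun j => x j * y j) k * d k|
        + ((n + 1) * C * u + secondOrderDot u C n) := by
  have hu : 0 ≤ u := (abs_nonneg _).trans (he 0)
  have hC : 0 ≤ C := (abs_nonneg _).trans (hz 0)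
  -- `|z_j ε_j| ≤ C u` and `|ẑ_j| ≤ C (1 + u)`
  have hze : ∀ j, |x j * y j * e j| ≤ C * u := fun j => by
    rw [abs_mul]
    exact mul_le_mul (hz j) (he j) (abs_nonneg _) hC
  have hzhC : ∀ j, |x j * y j * (1 + e j)| ≤ C * (1 + u) := fun j => by
    rw [abs_mul]
    refine mul_le_mul (hz j) ?_ (abs_nonneg _) hC
    calc |1 + e j| ≤ |1| + |e j| := abs_add_le _ _
      _ ≤ 1 + u := by rw [abs_one]; exact add_le_add le_rfl (he j)
  -- Lemma 2.1 for the data `ẑ`, and its second-order remainder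
  have h21 := recSum_sub_sum_eq_dataCoef_add_remCoef (fun j => x j * y j * (1 + e j)) d n
  have hrem := abs_sum_remCoef_mul_le_secondOrder hu (x := fun j => x j * y j * (1 + e j))
    (d := d) hd hzhC n
  -- `T_k = W_k + Σ_{j≤k} z_j ε_j`
  have hsplit : ∑ k ∈ range (n + 1), dataCoef (fun j => x j * y j * (1 + e j)) k * d k
      = ∑ k ∈ range (n + 1), dataCoef (fun j => x j * y j) k * d k
        + ∑ k ∈ range (n + 1), dataCoef (fun j => x j * y j * e j) k * d k := by
    rw [← sum_add_distrib]
    refine sum_congr rfl fun k _ => ?_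
    have h1 : (fun j => x j * y j * (1 + e j)) = fun j => x j * y j + x j * y j * e j :=
      funext fun j => by ring
    rw [h1, dataCoef_add, add_mul]
  have hpert := abs_sum_dataCoef_mul_le (w := fun j => x j * y j * e j) (d := d) hze hd n
  -- `|t − s| = |Σ_j z_j ε_j| ≤ (n+1) C u`
  have hts : |∑ j ∈ range (n + 1), x j * y j * (1 + e j) - ∑ j ∈ range (n + 1), x j * y j|
      ≤ (n + 1) * C * u := by
    rw [← sum_sub_distrib]
    have h1 : ∑ j ∈ range (n + 1), (x j * y j * (1 + e j) - x j * y j)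
        = ∑ j ∈ range (n + 1), x j * y j * e j :=
      sum_congr rfl fun j _ => by ring
    rw [h1]
    calc |∑ j ∈ range (n + 1), x j * y j * e j| ≤ ∑ j ∈ range (n + 1), |x j * y j * e j| :=
          abs_sum_le_sum_abs _ _
      _ ≤ ∑ _j ∈ range (n + 1), C * u := sum_le_sum fun j _ => hze j
      _ = (n + 1) * C * u := by rw [sum_const, card_range, nsmul_eq_mul]; push_cast; ring
  -- `ŝ − s = (t̂ − t) + (t − s)`
  have hdec : recDot x y e d n - ∑ j ∈ range (n + 1), x j * y j
      = (recSum (fun j => x j * y j * (1 + e j)) d n - ∑ j ∈ range (n + 1), x j * y j * (1 + e j))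
        + (∑ j ∈ range (n + 1), x j * y j * (1 + e j) - ∑ j ∈ range (n + 1), x j * y j) := by
    rw [recDot_eq_recSum]; ring
  rw [hdec, h21, hsplit]
  have hso := secondOrderDot_eq u C n
  calc |∑ k ∈ range (n + 1), dataCoef (fun j => x j * y j) k * d k
          + ∑ k ∈ range (n + 1), dataCoef (fun j => x j * y j * e j) k * d k
          + ∑ k ∈ range (n + 1), remCoef (fun j => x j * y j * (1 + e j)) d k * d k
          + (∑ j ∈ range (n + 1), x j * y j * (1 + e j) - ∑ j ∈ range (n + 1), x j * y j)|
      ≤ |∑ k ∈ range (n + 1), dataCoef (fun j => x j * y j) k * d k|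
          + |∑ k ∈ range (n + 1), dataCoef (fun j => x j * y j * e j) k * d k|
          + |∑ k ∈ range (n + 1), remCoef (fun j => x j * y j * (1 + e j)) d k * d k|
          + |∑ j ∈ range (n + 1), x j * y j * (1 + e j) - ∑ j ∈ range (n + 1), x j * y j| :=
        (abs_add_le _ _).trans (add_le_add ((abs_add_le _ _).trans
          (add_le_add (abs_add_le _ _) le_rfl)) le_rfl)
    _ ≤ |∑ k ∈ range (n + 1), dataCoef (fun j => x j * y j) k * d k|
          + n * ((n + 1) * (C * u)) * u + secondOrder u (C * (1 + u)) n + (n + 1) * C * u :=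
        add_le_add (add_le_add (add_le_add le_rfl hpert) hrem) hts
    _ = |∑ k ∈ range (n + 1), dataCoef (fun j => x j * y j) k * d k|
          + ((n + 1) * C * u + secondOrderDot u C n) := by
        rw [← hso]; ring

/-! ### THEOREM 3.2: inner products of random vectors -/

section InnerProduct

variable [IsProbabilityMeasure μ] {ξ η : ℕ → Ω → ℝ} {mx Cx my Cy u : ℝ} {δ ε : ℕ → Ω → ℝ}

/-- **THEOREM 3.2 (Higham–Mary 2020), eq. (3.2): probabilistic error bound for the inner product
of random vectors.** Let `x, y` satisfy Model 2 (means `μ_x, μ_y`, bounds `C_x, C_y`, all entries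
mutually independent), let `s = xᵀy = Σ_{j=0}^n x_j y_j` be computed by recursive summation of the
rounded products `ẑ_j = x_j y_j (1 + ε_j)`, `|ε_j| ≤ u`, with summation rounding errors `δ_k`
satisfying Model 3 (mean independent of the previous ones and of the data `z = (x_j y_j)_j`). Then
`|ŝ − s| ≤ (λ |μ_x μ_y| (n+1) √(n+1) + (λ² + 1) C_x C_y (n+1)) u + n (n+1) C_x C_y ((1+u)^n − 1) u`
(first order + explicit `O(u²)`) with probability at least `1 − 2(n+1) exp(−λ²/2)`: Lemma 2.7 for
the martingale `Σ_i W_i δ_i` of the data `z` (Model 2 with mean `μ_x μ_y`, bound `C_x C_y`), plus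
the sure bounds of `abs_recDot_sub_sum_le_dataCoef`. Compared with (2.14) for summation, the only
new first-order term is the "+1" of the initial multiplications. (Source indexing:
`(λ |μ_x μ_y| n^{3/2} + (λ² + 1) C_x C_y n) u + O(u²)`, probability `1 − 2n exp(−λ²/2)`.)
[cite: HighamMary2020, §3, Theorem 3.2, eq. (3.2)] -/
theorem recDot_probErrorBound_randomData (hxy : Model2Pair μ ξ η mx Cx my Cy)
    (hδ : Model3 μ u δ (fun j ω => ξ j ω * η j ω)) (hε : ∀ j ω, |ε j ω| ≤ u) (n : ℕ) {lam : ℝ}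
    (hlam : 0 < lam) :
    μ {ω | (lam * |mx * my| * (n + 1) * Real.sqrt (n + 1) + (lam ^ 2 + 1) * (Cx * Cy) * (n + 1)) * u
          + secondOrderDot u (Cx * Cy) n
        < |recDot (fun j => ξ j ω) (fun j => η j ω) (fun j => ε j ω) (fun i => δ i ω) n
            - ∑ j ∈ range (n + 1), ξ j ω * η j ω|}
      ≤ ENNReal.ofReal (2 * (n + 1) * Real.exp (-lam ^ 2 / 2)) := by
  refine (measure_mono ?_).trans (firstOrder_probBound hxy.mul hδ n hlam)
  intro ω hω
  simp only [Set.mem_setOf_eq] at hω ⊢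
  have hdet := abs_recDot_sub_sum_le_dataCoef (x := fun j => ξ j ω) (y := fun j => η j ω)
    (e := fun j => ε j ω) (d := fun i => δ i ω) (fun j => hxy.mul.bounded j ω) (fun j => hε j ω)
    (fun k => hδ.bounded k ω) n
  by_contra hle
  push Not at hle
  have : (lam * |mx * my| * (n + 1) * Real.sqrt (n + 1) + (lam ^ 2 + 1) * (Cx * Cy) * (n + 1)) * u
      + secondOrderDot u (Cx * Cy) n
      = (lam * |mx * my| * (n + 1) * Real.sqrt (n + 1) + lam ^ 2 * (Cx * Cy) * (n + 1)) * u
        + ((n + 1) * (Cx * Cy) * u + secondOrderDot u (Cx * Cy) n) := by ring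
  linarith

/-- **THEOREM 3.2 (Higham–Mary 2020), eq. (3.3): probabilistic BACKWARD ERROR bound for the inner
product of random vectors.** If moreover `|x|` and `|y|` satisfy Model 2 with means
`mxa = μ_|x|`, `mya = μ_|y|`, `0 < α` and `(1 − α) μ_|x| μ_|y| √(n+1) ≥ λ C_x C_y`, then with
probability at least `1 − 2(n+2) exp(−λ²/2)` the computed inner product is
`ŝ = Σ_j x_j y_j (1 + θ_j)` with `|θ_j| ≤ [(λ |μ_x μ_y| (n+1) √(n+1) + (λ² + 1) C_x C_y (n+1)) u
+ secondOrderDot u (C_x C_y) n] / (α μ_|x| μ_|y| (n+1))`, i.e. (3.1)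
`ε_bwd ≤ (α μ_|x| μ_|y|)⁻¹ (λ |μ_x μ_y| √(n+1) + (λ² + 1) C_x C_y) u + O(u²)` — of order `u` with
no `√n` growth as soon as EITHER vector has zero mean (eq. (3.2) for the numerator of (3.1),
Corollary 3.1 for the denominator `|x|ᵀ|y| ≥ α μ_|x| μ_|y| (n+1)`). (Source indexing: probability
`1 − 2(n+1) exp(−λ²/2)`.) [cite: HighamMary2020, §3, Theorem 3.2, eq. (3.3) with eq. (3.1)] -/
theorem recDot_probBackwardError_randomData (hxy : Model2Pair μ ξ η mx Cx my Cy) {mxa mya : ℝ}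
    (hax : ∀ j, ∫ ω, |ξ j ω| ∂μ = mxa) (hay : ∀ j, ∫ ω, |η j ω| ∂μ = mya)
    (hδ : Model3 μ u δ (fun j ω => ξ j ω * η j ω)) (hε : ∀ j ω, |ε j ω| ≤ u) (n : ℕ)
    {lam α : ℝ} (hlam : 0 < lam) (hα : 0 < α)
    (hcond : lam * (Cx * Cy) ≤ (1 - α) * (mxa * mya) * Real.sqrt (n + 1)) :
    μ {ω | ¬ IsBackwardSum (range (n + 1)) (fun j => ξ j ω * η j ω)
        (recDot (fun j => ξ j ω) (fun j => η j ω) (fun j => ε j ω) (fun i => δ i ω) n)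
        (((lam * |mx * my| * (n + 1) * Real.sqrt (n + 1) + (lam ^ 2 + 1) * (Cx * Cy) * (n + 1)) * u
          + secondOrderDot u (Cx * Cy) n) / (α * (mxa * mya) * (n + 1)))}
      ≤ ENNReal.ofReal (2 * (n + 2) * Real.exp (-lam ^ 2 / 2)) := by
  have hu : 0 ≤ u := hδ.u_nonneg
  have hC : 0 ≤ Cx * Cy := hxy.prod_const_nonneg
  have hl : 0 ≤ lam := hlam.le
  have hmx : 0 ≤ mxa := by rw [← hax 0]; exact integral_nonneg (fun ω => abs_nonneg _)
  have hmy : 0 ≤ mya := by rw [← hay 0]; exact integral_nonneg (fun ω => abs_nonneg _)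
  have hm0 : 0 ≤ mxa * mya := mul_nonneg hmx hmy
  set N : ℝ := (lam * |mx * my| * (n + 1) * Real.sqrt (n + 1)
      + (lam ^ 2 + 1) * (Cx * Cy) * (n + 1)) * u + secondOrderDot u (Cx * Cy) n with hN
  have hN0 : 0 ≤ N := by
    have h1 := secondOrderDot_nonneg hu hC n
    have h2 : 0 ≤ lam * |mx * my| * (n + 1) * Real.sqrt (n + 1) := by positivity
    have h3 : 0 ≤ (lam ^ 2 + 1) * (Cx * Cy) * (n + 1) :=
      mul_nonneg (mul_nonneg (by positivity) hC) (by positivity)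
    rw [hN]
    exact add_nonneg (mul_nonneg (add_nonneg h2 h3) hu) h1
  set D : ℝ := α * (mxa * mya) * (n + 1) with hD
  rcases hm0.eq_or_lt with hm | hmpos
  · -- degenerate case `μ_|x| μ_|y| = 0`: the condition forces `C_x C_y ≤ 0`, so every product
    -- `x_j y_j` vanishes, `ŝ = s = 0`, and no backward error bound can fail
    have hC' : Cx * Cy ≤ 0 := by
      have h1 : lam * (Cx * Cy) ≤ 0 := by rw [← hm] at hcond; simpa using hcond
      by_contra hpos
      exact absurd h1 (not_le.mpr (mul_pos hlam (not_le.mp hpos)))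
    have hz0 : ∀ j ω, ξ j ω * η j ω = 0 := fun j ω =>
      abs_nonpos_iff.mp ((hxy.mul.bounded j ω).trans hC')
    have hempty : {ω | ¬ IsBackwardSum (range (n + 1)) (fun j => ξ j ω * η j ω)
        (recDot (fun j => ξ j ω) (fun j => η j ω) (fun j => ε j ω) (fun i => δ i ω) n) (N / D)}
        = ∅ := by
      ext ω
      simp only [Set.mem_setOf_eq, Set.mem_empty_iff_false, iff_false, not_not]
      have hrec : recDot (fun j => ξ j ω) (fun j => η j ω) (fun j => ε j ω) (fun i => δ i ω) n
          = 0 := by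
        rw [recDot_eq_recSum]
        have hb := abs_recSum_le hu (fun j => ξ j ω * η j ω * (1 + ε j ω)) (fun i => δ i ω)
          (fun k => hδ.bounded k ω) n
        simp only [hz0, zero_mul, abs_zero, sum_const_zero, mul_zero] at hb ⊢
        exact abs_nonpos_iff.mp hb
      refine isBackwardSum_of_abs_sub_le (div_nonneg hN0 (by rw [hD, ← hm]; simp)) ?_
      rw [hrec]
      simp [hz0]
    rw [hempty, measure_empty]
    exact bot_le
  · have hDpos : 0 < D := by rw [hD]; exact mul_pos (mul_pos hα hmpos) (by positivity)
    -- failure ⊆ {N < |ŝ − s|} ∪ {|x|ᵀ|y| < D}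
    have hsplit : {ω | ¬ IsBackwardSum (range (n + 1)) (fun j => ξ j ω * η j ω)
          (recDot (fun j => ξ j ω) (fun j => η j ω) (fun j => ε j ω) (fun i => δ i ω) n) (N / D)}
        ⊆ {ω | N < |recDot (fun j => ξ j ω) (fun j => η j ω) (fun j => ε j ω) (fun i => δ i ω) n
              - ∑ j ∈ range (n + 1), ξ j ω * η j ω|}
          ∪ {ω | ∑ j ∈ range (n + 1), |ξ j ω * η j ω| < α * (mxa * mya) * (n + 1)} := by
      intro ω hω
      simp only [Set.mem_setOf_eq, Set.mem_union] at hω ⊢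
      by_contra hcon
      push Not at hcon
      obtain ⟨h1, h2⟩ := hcon
      refine hω (isBackwardSum_of_abs_sub_le (div_nonneg hN0 hDpos.le) (h1.trans ?_))
      calc N = N / D * D := (div_mul_cancel₀ N hDpos.ne').symm
        _ ≤ N / D * ∑ j ∈ range (n + 1), |ξ j ω * η j ω| :=
            mul_le_mul_of_nonneg_left h2 (div_nonneg hN0 hDpos.le)
    have h32 := recDot_probErrorBound_randomData hxy hδ hε n hlam
    have h31 := hxy.absDot_lower_probBound hax hay n hl hcond
    calc μ {ω | ¬ IsBackwardSum (range (n + 1)) (fun j => ξ j ω * η j ω)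
            (recDot (fun j => ξ j ω) (fun j => η j ω) (fun j => ε j ω) (fun i => δ i ω) n) (N / D)}
        ≤ μ ({ω | N < |recDot (fun j => ξ j ω) (fun j => η j ω) (fun j => ε j ω) (fun i => δ i ω) n
              - ∑ j ∈ range (n + 1), ξ j ω * η j ω|}
          ∪ {ω | ∑ j ∈ range (n + 1), |ξ j ω * η j ω| < α * (mxa * mya) * (n + 1)}) :=
          measure_mono hsplit
      _ ≤ μ {ω | N < |recDot (fun j => ξ j ω) (fun j => η j ω) (fun j => ε j ω) (fun i => δ i ω) n
              - ∑ j ∈ range (n + 1), ξ j ω * η j ω|}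
          + μ {ω | ∑ j ∈ range (n + 1), |ξ j ω * η j ω| < α * (mxa * mya) * (n + 1)} :=
          measure_union_le _ _
      _ ≤ ENNReal.ofReal (2 * (n + 1) * Real.exp (-lam ^ 2 / 2))
          + ENNReal.ofReal (2 * Real.exp (-lam ^ 2 / 2)) := add_le_add h32 h31
      _ = ENNReal.ofReal (2 * (n + 2) * Real.exp (-lam ^ 2 / 2)) := by
          rw [← ENNReal.ofReal_add (by positivity) (by positivity)]
          ring_nf

end InnerProduct

/-! ### Eq. (3.6) and THEOREM 3.3: matrix–vector products -/

section MatVec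

variable {ι : Type*}

/-- **Eq. (3.6), the Oettli–Prager reading of the backward error of `y = Ax`:** if every
component `ŷ_i` (`i ∈ rows`) is the exact inner product of row `i` with `x` up to relative
perturbations `θ_ij`, `|θ_ij| ≤ ε`, of the products (`IsBackwardSum`, row by row), then
`ŷ = (A + ΔA) x` with `|ΔA| ≤ ε |A|` componentwise, i.e. `ε_bwd(ŷ) = min{ε : ŷ = (A + ΔA)x,
|ΔA| ≤ ε|A|} ≤ ε`. (The tree's `BlanchardHighamMary2020.theorem42_mulVec`.)
[cite: HighamMary2020, §3, eq. (3.6) ("where the last equality follows from the Oettli–Prager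
theorem")] -/
theorem exists_perturbation_of_rows {K : Type*} [Field K] [LinearOrder K] [IsStrictOrderedRing K]
    {κ : Type*} (rows : Finset ι) (cols : Finset κ) (a : ι → κ → K) (x : κ → K) (ŷ : ι → K)
    {e : K} (h : ∀ i ∈ rows, IsBackwardSum cols (fun j => a i j * x j) (ŷ i) e) :
    ∃ ΔA : ι → κ → K, (∀ i ∈ rows, ∀ j ∈ cols, |ΔA i j| ≤ e * |a i j|) ∧
      ∀ i ∈ rows, ŷ i = ∑ j ∈ cols, (a i j + ΔA i j) * x j :=
  theorem42_mulVec rows cols a x ŷ (fun i hi => h i hi)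

variable [IsProbabilityMeasure μ] {A : ι → ℕ → Ω → ℝ} {ξ : ℕ → Ω → ℝ} {mA CA mx Cx u : ℝ}
  {δ ε : ι → ℕ → Ω → ℝ}

/-- **THEOREM 3.3 (Higham–Mary 2020), eq. (3.7): probabilistic backward error bound for
matrix–vector products with random data.** Let `A` (rows `i ∈ rows`, `m = #rows`) and `x` satisfy
Model 2 (means `μ_A, μ_x`, bounds `C_A, C_x`, all entries mutually independent), let `|A|` and
`|x|` satisfy Model 2 with means `mAa = μ_|A|`, `mxa = μ_|x|`, and let `y = Ax` be computed by `m`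
inner products of length `n + 1`, the `i`-th with multiplication errors `|ε^{(i)}_j| ≤ u` and
summation errors `δ^{(i)}` satisfying Model 3. If `0 < α` and
`(1 − α) μ_|A| μ_|x| √(n+1) ≥ λ C_A C_x` then, with probability at least `1 − 2m(n+2) exp(−λ²/2)`,
EVERY component satisfies the backward error bound of Theorem 3.2 — hence (by (3.6),
`exists_perturbation_of_rows`) `ŷ = (A + ΔA)x`, `|ΔA| ≤ ε|A|` with
`ε = [(λ |μ_A μ_x| (n+1) √(n+1) + (λ² + 1) C_A C_x (n+1)) u + secondOrderDot u (C_A C_x) n]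
/ (α μ_|A| μ_|x| (n+1))`, the bound (3.7)
`ε_bwd(ŷ) ≤ (α μ_|A| μ_|x|)⁻¹ (λ |μ_A μ_x| √n + (λ² + 1) C_A C_x) u + O(u²)`: Theorem 3.2 for each
row ("the probability of failure is larger by a factor `m`"). (Source indexing: probability
`1 − 2m(n+1) exp(−λ²/2)`.) [cite: HighamMary2020, §3, Theorem 3.3, eq. (3.7)] -/
theorem mulVec_probBackwardError_randomData (rows : Finset ι)
    (hAx : Model2Pair μ (fun p : ι × ℕ => A p.1 p.2) ξ mA CA mx Cx) {mAa mxa : ℝ}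
    (haA : ∀ i j, ∫ ω, |A i j ω| ∂μ = mAa) (hax : ∀ j, ∫ ω, |ξ j ω| ∂μ = mxa)
    (hδ : ∀ i ∈ rows, Model3 μ u (δ i) (fun j ω => A i j ω * ξ j ω))
    (hε : ∀ i j ω, |ε i j ω| ≤ u) (n : ℕ) {lam α : ℝ} (hlam : 0 < lam) (hα : 0 < α)
    (hcond : lam * (CA * Cx) ≤ (1 - α) * (mAa * mxa) * Real.sqrt (n + 1)) :
    μ {ω | ∃ i ∈ rows, ¬ IsBackwardSum (range (n + 1)) (fun j => A i j ω * ξ j ω)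
        (recDot (fun j => A i j ω) (fun j => ξ j ω) (fun j => ε i j ω) (fun k => δ i k ω) n)
        (((lam * |mA * mx| * (n + 1) * Real.sqrt (n + 1) + (lam ^ 2 + 1) * (CA * Cx) * (n + 1)) * u
          + secondOrderDot u (CA * Cx) n) / (α * (mAa * mxa) * (n + 1)))}
      ≤ ENNReal.ofReal (2 * rows.card * (n + 2) * Real.exp (-lam ^ 2 / 2)) := by
  set e : ℝ := ((lam * |mA * mx| * (n + 1) * Real.sqrt (n + 1)
      + (lam ^ 2 + 1) * (CA * Cx) * (n + 1)) * u + secondOrderDot u (CA * Cx) n)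
      / (α * (mAa * mxa) * (n + 1)) with he
  set p : ℝ := 2 * (n + 2) * Real.exp (-lam ^ 2 / 2) with hp
  -- Theorem 3.2 for row `i`: the pair (row `i` of `A`, `x`) satisfies the §3 convention
  have hrow : ∀ i ∈ rows, μ {ω | ¬ IsBackwardSum (range (n + 1)) (fun j => A i j ω * ξ j ω)
      (recDot (fun j => A i j ω) (fun j => ξ j ω) (fun j => ε i j ω) (fun k => δ i k ω) n) e}
      ≤ ENNReal.ofReal p := by
    intro i hi
    have hpair : Model2Pair μ (fun j => A i j) ξ mA CA mx Cx :=
      hAx.restrict (f := fun j : ℕ => (i, j)) (g := id) (fun a b hab => (Prod.mk.inj hab).2)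
        Function.injective_id
    exact recDot_probBackwardError_randomData hpair (fun j => haA i j) hax (hδ i hi)
      (fun j ω => hε i j ω) n hlam hα hcond
  calc μ {ω | ∃ i ∈ rows, ¬ IsBackwardSum (range (n + 1)) (fun j => A i j ω * ξ j ω)
          (recDot (fun j => A i j ω) (fun j => ξ j ω) (fun j => ε i j ω) (fun k => δ i k ω) n) e}
      ≤ μ (⋃ i ∈ rows, {ω | ¬ IsBackwardSum (range (n + 1)) (fun j => A i j ω * ξ j ω)
          (recDot (fun j => A i j ω) (fun j => ξ j ω) (fun j => ε i j ω) (fun k => δ i k ω) n)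
          e}) := by
        refine measure_mono fun ω hω => ?_
        simp only [Set.mem_setOf_eq] at hω
        simp only [Set.mem_iUnion, Set.mem_setOf_eq, exists_prop]
        exact hω
    _ ≤ ∑ i ∈ rows, μ {ω | ¬ IsBackwardSum (range (n + 1)) (fun j => A i j ω * ξ j ω)
          (recDot (fun j => A i j ω) (fun j => ξ j ω) (fun j => ε i j ω) (fun k => δ i k ω) n)
          e} :=
        measure_biUnion_finset_le _ _
    _ ≤ ∑ _i ∈ rows, ENNReal.ofReal p := sum_le_sum hrow
    _ = ENNReal.ofReal (2 * rows.card * (n + 2) * Real.exp (-lam ^ 2 / 2)) := by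
        rw [sum_const, nsmul_eq_mul, ← ENNReal.ofReal_natCast,
          ← ENNReal.ofReal_mul (by positivity), hp]
        ring_nf

end MatVec

/-! ### THEOREM 3.4: matrix–matrix products -/

section MatMul

variable {ι κ : Type*} [IsProbabilityMeasure μ] {A : ι → ℕ → Ω → ℝ} {B : ℕ → κ → Ω → ℝ}
  {mA CA mB CB u : ℝ} {δ ε : ι → κ → ℕ → Ω → ℝ}

/-- **THEOREM 3.4 (Higham–Mary 2020), eq. (3.8): probabilistic error bound for matrix
multiplication with random data.** Let `A` (rows `i ∈ rows`, `m = #rows`) and `B` (columns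
`k ∈ cols`, `p = #cols`) satisfy Model 2 (means `μ_A, μ_B`, bounds `C_A, C_B`, all entries
mutually independent) and let `C = AB` (inner dimension `n + 1`) be computed entrywise by inner
products, the `(i,k)`-th with multiplication errors `|ε^{(i,k)}_j| ≤ u` and summation errors
`δ^{(i,k)}` satisfying Model 3. Then
`max_{i,k} |(Ĉ − C)_{ik}| ≤ (λ |μ_A μ_B| (n+1) √(n+1) + (λ² + 1) C_A C_B (n+1)) u
+ secondOrderDot u (C_A C_B) n` with probability at least `1 − 2 m (n+1) p exp(−λ²/2)` (eq. (3.2)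
of Theorem 3.2 for each of the `mp` entries and a union bound). (Source indexing:
`(λ |μ_A μ_B| n^{3/2} + (λ² + 1) C_A C_B n) u + O(u²)`, probability `1 − 2mnp exp(−λ²/2)`.)
[cite: HighamMary2020, §3, Theorem 3.4, eq. (3.8)] -/
theorem matMul_probErrorBound_randomData (rows : Finset ι) (cols : Finset κ)
    (hAB : Model2Pair μ (fun p : ι × ℕ => A p.1 p.2) (fun q : ℕ × κ => B q.1 q.2) mA CA mB CB)
    (hδ : ∀ i ∈ rows, ∀ k ∈ cols, Model3 μ u (δ i k) (fun j ω => A i j ω * B j k ω))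
    (hε : ∀ i k j ω, |ε i k j ω| ≤ u) (n : ℕ) {lam : ℝ} (hlam : 0 < lam) :
    μ {ω | ∃ i ∈ rows, ∃ k ∈ cols,
        (lam * |mA * mB| * (n + 1) * Real.sqrt (n + 1) + (lam ^ 2 + 1) * (CA * CB) * (n + 1)) * u
            + secondOrderDot u (CA * CB) n
          < |recDot (fun j => A i j ω) (fun j => B j k ω) (fun j => ε i k j ω) (fun l => δ i k l ω) n
              - ∑ j ∈ range (n + 1), A i j ω * B j k ω|}
      ≤ ENNReal.ofReal (2 * rows.card * (n + 1) * cols.card * Real.exp (-lam ^ 2 / 2)) := by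
  set b : ℝ := (lam * |mA * mB| * (n + 1) * Real.sqrt (n + 1)
      + (lam ^ 2 + 1) * (CA * CB) * (n + 1)) * u + secondOrderDot u (CA * CB) n with hb
  set p : ℝ := 2 * (n + 1) * Real.exp (-lam ^ 2 / 2) with hp
  -- the failure event of entry `(i, k)`
  set F : ι → κ → Set Ω := fun i k => {ω | b
      < |recDot (fun j => A i j ω) (fun j => B j k ω) (fun j => ε i k j ω) (fun l => δ i k l ω) n
          - ∑ j ∈ range (n + 1), A i j ω * B j k ω|} with hF
  -- Theorem 3.2 for entry `(i, k)`: the pair (row `i` of `A`, column `k` of `B`)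
  have hentry : ∀ i ∈ rows, ∀ k ∈ cols, μ (F i k) ≤ ENNReal.ofReal p := by
    intro i hi k hk
    have hpair : Model2Pair μ (fun j => A i j) (fun j => B j k) mA CA mB CB :=
      hAB.restrict (f := fun j : ℕ => (i, j)) (g := fun j : ℕ => (j, k))
        (fun a a' h => (Prod.mk.inj h).2) (fun a a' h => (Prod.mk.inj h).1)
    exact recDot_probErrorBound_randomData hpair (hδ i hi k hk) (fun j ω => hε i k j ω) n hlam
  have hrow : ∀ i ∈ rows, μ (⋃ k ∈ cols, F i k) ≤ ENNReal.ofReal (cols.card * p) := by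
    intro i hi
    calc μ (⋃ k ∈ cols, F i k) ≤ ∑ k ∈ cols, μ (F i k) := measure_biUnion_finset_le _ _
      _ ≤ ∑ _k ∈ cols, ENNReal.ofReal p := sum_le_sum fun k hk => hentry i hi k hk
      _ = ENNReal.ofReal (cols.card * p) := by
          rw [sum_const, nsmul_eq_mul, ENNReal.ofReal_mul (Nat.cast_nonneg _),
            ENNReal.ofReal_natCast]
  calc μ {ω | ∃ i ∈ rows, ∃ k ∈ cols, b
          < |recDot (fun j => A i j ω) (fun j => B j k ω) (fun j => ε i k j ω) (fun l => δ i k l ω) n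
              - ∑ j ∈ range (n + 1), A i j ω * B j k ω|}
      ≤ μ (⋃ i ∈ rows, ⋃ k ∈ cols, F i k) := by
        refine measure_mono fun ω hω => ?_
        simp only [Set.mem_setOf_eq] at hω
        simp only [Set.mem_iUnion, hF, Set.mem_setOf_eq, exists_prop]
        exact hω
    _ ≤ ∑ i ∈ rows, μ (⋃ k ∈ cols, F i k) := measure_biUnion_finset_le _ _
    _ ≤ ∑ _i ∈ rows, ENNReal.ofReal (cols.card * p) := sum_le_sum hrow
    _ = ENNReal.ofReal (2 * rows.card * (n + 1) * cols.card * Real.exp (-lam ^ 2 / 2)) := by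
        rw [sum_const, nsmul_eq_mul, ← ENNReal.ofReal_natCast,
          ← ENNReal.ofReal_mul (Nat.cast_nonneg _), hp]
        ring_nf

end MatMul

end Literature.ComputerArithmetic.HighamMary2020
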